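import Summits.Ventures.PercRepro.S1DisjointSumY

/-!
# PercRepro — THE DOUBLE COUNT ON THE TOP TWO RANK LEVELS OF A COLOOP-FREE MATROID (p2, gen 28;
SUBCLAIM-S1 §6.10 (xvii)(f))

`2 · f(r − 1) ≤ r · f(r)` for a coloop-free finite matroid of rank `r ≥ 1`, where
`f(a) = #{A ⊆ E : ρ(A) = a}` (`rankSet`). Count the pairs `(A, x)` with `ρ(A) = r − 1` and `x ∈ E ∖ cl A`
(`extPairs`): every `A` has at least two such `x` (`cl A` is a hyperplane; were only one point `x` missing,
`E ∖ {x} ⊆ cl A` would make `x` a coloop), and every set `S = A ∪ {x}` — spanning, of rank `r` — arises from at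
most `r` pairs (`x ∉ cl(S ∖ {x})`, and the elements of `S` with that property form an independent set). This is
the profile inequality `P(M₁)` of the 4-circuit-summand consumer (`2.2 f(5) ≤ 11 f(6)` is `f(5) ≤ 5 f(6)`, and
the double count gives `f(5) ≤ 3 f(6)`). Nothing is claimed about any cell.

* `extPairs` — the extension pairs at a level; `extPairs_finite`;
* `two_le_ncard_ground_sdiff_closure` — a rank-`(r − 1)` set of a coloop-free rank-`r` matroid misses at least
  two points of its closure's complement;
* `indep_setOf_notMem_closure_sdiff`, `ncard_setOf_notMem_closure_sdiff_le` — the «private» elements of a set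
  are independent, hence at most `r` of them;
* `two_mul_ncard_rankSet_le_ncard_extPairs`, `ncard_extPairs_le` — the two sides of the double count;
* **`two_mul_ncard_rankSet_le`** — `2 · f(r − 1) ≤ r · f(r)`.
Axioms: standard.
-/

open scoped Matroid

namespace PercRepro

namespace S1

open Set

variable {α : Type}

/-- The extension pairs at level `k`: `(A, x)` with `A ⊆ E`, `ρ(A) = k` and `x ∈ E ∖ cl A`. -/
def extPairs (M : Matroid α) (k : ℕ) : Set (Set α × α) :=
  {P : Set α × α | P.1 ∈ rankSet M k ∧ P.2 ∈ M.E \ M.closure P.1}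

/-- A rank-level set of a finite matroid is finite. -/
theorem rankSet_finite (M : Matroid α) [M.Finite] (k : ℕ) : (rankSet M k).Finite :=
  M.ground_finite.finite_subsets.subset (fun _ hA => hA.1)

/-- The extension pairs of a finite matroid form a finite set. -/
theorem extPairs_finite (M : Matroid α) [M.Finite] (k : ℕ) : (extPairs M k).Finite :=
  (M.ground_finite.finite_subsets.prod M.ground_finite).subset
    (fun _ hP => ⟨hP.1.1, hP.2.1⟩)

/-- **At least two extension points**: in a coloop-free matroid of rank `r + 1`, a set of rank `r` has at least
two points of the ground set outside its closure. -/
theorem two_le_ncard_ground_sdiff_closure (M : Matroid α) [M.Finite] {r : ℕ} (hr : M.eRank = r + 1)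
    (hcol : M.coloops = ∅) {A : Set α} (hA : A ∈ rankSet M r) : 2 ≤ (M.E \ M.closure A).ncard := by
  obtain ⟨_, hrA⟩ := hA
  have hfin : (M.E \ M.closure A).Finite := M.ground_finite.subset sdiff_subset
  by_contra hlt
  have h1 : (M.E \ M.closure A).ncard ≤ 1 := by omega
  rw [ncard_le_one_iff_eq hfin] at h1
  rcases h1 with h0 | ⟨x, hx⟩
  · -- the whole ground set lies in `cl A`, so the rank of `M` is at most `r`
    have hsub : M.E ⊆ M.closure A := by
      intro y hy
      by_contra hy'
      have hmem : y ∈ M.E \ M.closure A := ⟨hy, hy'⟩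
      rw [h0] at hmem
      exact hmem
    have hle := M.eRk_mono hsub
    rw [M.eRk_closure_eq, ← M.eRank_def, hr, hrA] at hle
    have hle' : r + 1 ≤ r := by exact_mod_cast hle
    omega
  · -- exactly one point `x` is missing: it is a coloop
    have hxmem : x ∈ M.E \ M.closure A := by rw [hx]; exact mem_singleton x
    have hsub : M.E \ {x} ⊆ M.closure A := by
      intro y hy
      by_contra hy'
      have hmem : y ∈ M.E \ M.closure A := ⟨hy.1, hy'⟩
      rw [hx] at hmem
      exact hy.2 hmem
    have hcolx : M.IsColoop x := by
      rw [Matroid.isColoop_iff_notMem_closure_compl hxmem.1]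
      intro hmem
      have h2 := M.closure_subset_closure hsub hmem
      rw [M.closure_closure] at h2
      exact hxmem.2 h2
    have hmem : x ∈ M.coloops := hcolx
    rw [hcol] at hmem
    exact hmem

/-- The elements of `S ⊆ E` outside the closure of the rest of `S` form an independent set. -/
theorem indep_setOf_notMem_closure_sdiff (M : Matroid α) {S : Set α} (hS : S ⊆ M.E) :
    M.Indep {x ∈ S | x ∉ M.closure (S \ {x})} := by
  rw [Matroid.indep_iff_forall_notMem_closure_sdiff (fun x hx => hS hx.1)]
  intro e he hmem
  apply he.2
  refine M.closure_subset_closure ?_ hmem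
  intro y hy
  exact ⟨hy.1.1, hy.2⟩

/-- At most `r` elements of `S ⊆ E` lie outside the closure of the rest of `S`, `r` the rank of `M`. -/
theorem ncard_setOf_notMem_closure_sdiff_le (M : Matroid α) [M.Finite] {r : ℕ} (hr : M.eRank = r)
    {S : Set α} (hS : S ⊆ M.E) : {x ∈ S | x ∉ M.closure (S \ {x})}.ncard ≤ r := by
  have h := (indep_setOf_notMem_closure_sdiff M hS).encard_le_eRank
  rw [hr] at h
  exact (encard_le_coe_iff_finite_ncard_le.mp h).2

/-- The fibre of `(A, x) ↦ A ∪ {x}` over `S`. -/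
def extFibre (M : Matroid α) (k : ℕ) (S : Set α) : Set (Set α × α) :=
  {P ∈ extPairs M k | insert P.2 P.1 = S}

/-- **The fibre over `S` has at most `r` members**: `(A, x) ↦ x` is injective on it, into the independent
set of «private» elements of `S`. -/
theorem ncard_extFibre_le (M : Matroid α) [M.Finite] {r : ℕ} (hr : M.eRank = r) (k : ℕ) {S : Set α}
    (hS : S ⊆ M.E) : (extFibre M k S).ncard ≤ r := by
  refine le_trans ?_ (ncard_setOf_notMem_closure_sdiff_le M hr hS)
  have hfinI : {x ∈ S | x ∉ M.closure (S \ {x})}.Finite := M.ground_finite.subset (fun x hx => hS hx.1)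
  refine ncard_le_ncard_of_injOn (fun P : Set α × α => P.2) ?_ ?_ hfinI
  · rintro ⟨A, x⟩ ⟨⟨⟨hAE, -⟩, hxE, hxcl⟩, hAx⟩
    have hxA : x ∉ A := fun hxA => hxcl (M.subset_closure A hAE hxA)
    refine ⟨?_, ?_⟩
    · show x ∈ S
      rw [← hAx]; exact mem_insert x A
    · show x ∉ M.closure (S \ {x})
      rw [← hAx, insert_sdiff_self_of_notMem hxA]
      exact hxcl
  · rintro ⟨A, x⟩ ⟨⟨⟨hAE, -⟩, -, hxcl⟩, hAx⟩ ⟨B, y⟩ ⟨⟨⟨hBE, -⟩, -, hycl⟩, hBy⟩ hxy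
    have hxy' : x = y := hxy
    subst hxy'
    have hxA : x ∉ A := fun hxA => hxcl (M.subset_closure A hAE hxA)
    have hxB : x ∉ B := fun hxB => hycl (M.subset_closure B hBE hxB)
    have hAB : A = B := by
      rw [← insert_sdiff_self_of_notMem hxA, ← insert_sdiff_self_of_notMem hxB, hAx, hBy]
    rw [hAB]

/-- **The upper side of the double count**: the extension pairs at level `r` number at most
`(r + 1) · f(r + 1)`, `r + 1` the rank. -/
theorem ncard_extPairs_le (M : Matroid α) [M.Finite] {r : ℕ} (hr : M.eRank = r + 1) :
    (extPairs M r).ncard ≤ (r + 1) * (rankSet M (r + 1)).ncard := by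
  have hT : (rankSet M (r + 1)).Finite := rankSet_finite M (r + 1)
  have hsub : extPairs M r ⊆ ⋃ S ∈ rankSet M (r + 1), extFibre M r S := by
    rintro ⟨A, x⟩ ⟨⟨hAE, hrA⟩, hxE, hxcl⟩
    rw [mem_iUnion₂]
    refine ⟨insert x A, ⟨insert_subset hxE hAE, ?_⟩, ⟨⟨hAE, hrA⟩, hxE, hxcl⟩, rfl⟩
    rw [Matroid.eRk_insert_eq_add_one ⟨hxE, hxcl⟩, hrA]
    push_cast
    rfl
  have hfib_fin : ∀ S ∈ rankSet M (r + 1), (extFibre M r S).Finite :=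
    fun S _ => (extPairs_finite M r).subset (fun P hP => hP.1)
  calc (extPairs M r).ncard ≤ (⋃ S ∈ rankSet M (r + 1), extFibre M r S).ncard :=
        ncard_le_ncard hsub (hT.biUnion hfib_fin)
    _ ≤ ∑ᶠ S ∈ rankSet M (r + 1), (extFibre M r S).ncard := hT.ncard_biUnion_le _
    _ = ∑ S ∈ hT.toFinset, (extFibre M r S).ncard := finsum_mem_eq_finite_toFinset_sum _ hT
    _ ≤ hT.toFinset.card • (r + 1) := by
        apply Finset.sum_le_card_nsmul
        intro S hS
        rw [Finite.mem_toFinset] at hS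
        exact ncard_extFibre_le M hr r hS.1
    _ = (r + 1) * (rankSet M (r + 1)).ncard := by
        rw [smul_eq_mul, ncard_eq_toFinset_card _ hT, mul_comm]

/-- **The lower side of the double count**: the extension pairs at level `r` number at least `2 · f(r)`
when `M` is coloop-free of rank `r + 1`. -/
theorem two_mul_ncard_rankSet_le_ncard_extPairs (M : Matroid α) [M.Finite] {r : ℕ}
    (hr : M.eRank = r + 1) (hcol : M.coloops = ∅) : 2 * (rankSet M r).ncard ≤ (extPairs M r).ncard := by
  have hT : (rankSet M r).Finite := rankSet_finite M r
  have heq : extPairs M r = ⋃ A ∈ rankSet M r, ({A} ×ˢ (M.E \ M.closure A) : Set (Set α × α)) := by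
    ext ⟨A, x⟩
    simp only [extPairs, mem_setOf_eq, mem_iUnion, mem_prod, mem_singleton_iff, exists_prop]
    constructor
    · rintro ⟨hA, hx⟩
      exact ⟨A, hA, rfl, hx⟩
    · rintro ⟨B, hB, rfl, hx⟩
      exact ⟨hB, hx⟩
  have hfin : ∀ A ∈ rankSet M r, (({A} ×ˢ (M.E \ M.closure A) : Set (Set α × α))).Finite :=
    fun A _ => (finite_singleton A).prod (M.ground_finite.subset sdiff_subset)
  have hdisj : (rankSet M r).PairwiseDisjoint
      (fun A : Set α => ({A} ×ˢ (M.E \ M.closure A) : Set (Set α × α))) := by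
    intro A _ B _ hAB
    rw [Function.onFun, Set.disjoint_left]
    rintro ⟨C, x⟩ ⟨hC1, -⟩ ⟨hC2, -⟩
    apply hAB
    rw [mem_singleton_iff] at hC1 hC2
    rw [← hC1, ← hC2]
  rw [heq, hT.ncard_biUnion hfin hdisj, finsum_mem_eq_finite_toFinset_sum _ hT]
  calc 2 * (rankSet M r).ncard = hT.toFinset.card • 2 := by
        rw [smul_eq_mul, ncard_eq_toFinset_card _ hT, mul_comm]
    _ ≤ ∑ A ∈ hT.toFinset, (({A} ×ˢ (M.E \ M.closure A) : Set (Set α × α))).ncard := by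
        apply Finset.card_nsmul_le_sum
        intro A hA
        rw [Finite.mem_toFinset] at hA
        rw [ncard_prod, ncard_singleton, one_mul]
        exact two_le_ncard_ground_sdiff_closure M hr hcol hA

/-- **THE DOUBLE COUNT**: for a coloop-free finite matroid of rank `r + 1`,
`2 · #{A ⊆ E : ρ(A) = r} ≤ (r + 1) · #{A ⊆ E : ρ(A) = r + 1}`. -/
theorem two_mul_ncard_rankSet_le (M : Matroid α) [M.Finite] {r : ℕ} (hr : M.eRank = r + 1)
    (hcol : M.coloops = ∅) : 2 * (rankSet M r).ncard ≤ (r + 1) * (rankSet M (r + 1)).ncard :=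
  (two_mul_ncard_rankSet_le_ncard_extPairs M hr hcol).trans (ncard_extPairs_le M hr)

end S1

end PercRepro
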